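import Literature.AlgebraicGeometry.HodgeTheory.SurjectivePushPullSplitting
import HarnessLib

/-!
# Coniveau and algebraicity descend along every surjective morphism of smooth projective complex
# varieties: `g^* x ∈ Nᶜ Hᵏ(X) ⟹ x ∈ Nᶜ Hᵏ(W)` (any relative dimension)

Family `hodge`, layer `Literature/AlgebraicGeometry/HodgeTheory`; lane `lit-hodgefound`. THEOREMS ONLY
(no definition, no named fact; D-0026). The tree's `SurjectivePullbackAlgebraicClasses`
(`mem_supportedClasses_of_map_mem_of_surjective`, `mem_algebraicClasses_of_map_mem_of_surjective`:
Schoen's transfer step, Compositio 65 (1988) Cor. 3.1 / Thm. 3.2, "the cycles on this product … push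
forward to give the required cycles", through Voisin I Rem. 7.29 `φ_* φ^* = deg φ · id`) treats
surjections between varieties of the SAME dimension. For a surjection `g : X ⟶ W` of relative dimension
`r = dim X − dim W > 0` one has `g_* g^* = 0` for degree reasons; the substitute is the splitting
`g_*(ηʳ ∪ g^* x) = c · x`, `c ≠ 0`, for the hyperplane class `η` (Voisin I Lemma 7.28 with the wedge
kept; the tree's `SurjectivePushPullSplitting`), and cupping with the DIVISOR class `η` raises the
geometric coniveau by one (`lefschetzPow_mem_supportedClasses_add`, the divisor case of Voisin II
Prop. 9.20 — no moving lemma), while Gysin morphisms carry `N^{c+r} H^{k+2r}(X)` to `Nᶜ Hᵏ(W)`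
(`complexGysin_mem_supportedClasses`). Hence, for EVERY surjective `g : X ⟶ W` of smooth projective
complex varieties:

* `mem_supportedClasses_of_map_mem_of_surjective_of_add_eq`, **`mem_supportedClasses_of_map_mem_of_surjective'`**
  — `g^* x ∈ Nᶜ Hᵏ(X(ℂ); ℂ) ⟹ x ∈ Nᶜ Hᵏ(W(ℂ); ℂ)` (coniveau descends);
* **`mem_algebraicClasses_of_map_mem_of_surjective'`** — `g^* x` algebraic ⟹ `x` algebraic;
  `le_algebraicClasses_of_map_le_of_surjective'` (subspace form);
* `supportedClasses_comap_map_le_of_surjective` — `(g^*)⁻¹ Nᶜ Hᵏ(X) ≤ Nᶜ Hᵏ(W)` as submodules.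

## References

* [Voisin2002] [VoisinHodgeI2002] C. Voisin, Hodge Theory and Complex Algebraic Geometry I, CUP 2002,
  §7.3.2 Lemma 7.28 (p. 150) and Remark 7.29.
* [VoisinHodgeII2003] C. Voisin, Hodge Theory and Complex Algebraic Geometry II, CUP 2003, §9.2.4
  Prop. 9.20, Prop. 9.21 (ii).
* [Schoen1988HodgeWeil] C. Schoen, Hodge classes on self-products of a variety with an automorphism,
  Compositio Math. 65 (1988), §3 Cor. 3.1 (proof, pp. 24–25), Thm. 3.2 (proof, p. 25).
* [FultonYoungTableaux1997] W. Fulton, Young Tableaux, CUP 1997, Appendix B §B.1 (5)–(7), §B.2 Ex. 5.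
-/

noncomputable section

open CategoryTheory AlgebraicGeometry
open Literature.AlgebraicTopology.SingularHomology Literature.Geometry.Kaehler
open Literature.AlgebraicGeometry.Motives (IsSmoothProjective ComplexPoints)

namespace Literature.AlgebraicGeometry.HodgeTheory

variable {n m : ℕ} {X W : Motives.SchemeOver ℂ}

/-- **Coniveau descends along a surjective morphism of relative dimension `r`**: for `g : X ⟶ W`
surjective, `dim X = dim W + r`, and `x ∈ Hᵏ(W(ℂ); ℂ)` with `g^* x ∈ Nᶜ Hᵏ(X(ℂ); ℂ)`, also
`x ∈ Nᶜ Hᵏ(W(ℂ); ℂ)`: `x = c₀⁻¹ • g_*(Lʳ_η(g^* x))` for the rational Kähler class `η` of a Kähler–rational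
datum (`KaehlerRationalDatum.exists_complexGysin_lefschetzPow_map_eq_smul_of_surjective`), `Lʳ_η` raises the
coniveau by `r` (`η` is a divisor class) and `g_*` maps `N^{c+r} H^{k+2r}(X)` into `Nᶜ Hᵏ(W)`.
[cite: Voisin2002, §7.3.2 Lemma 7.28 and Remark 7.29] [cite: VoisinHodgeII2003, §9.2.4 Prop. 9.20 and Prop. 9.21 (ii)]
[cite: FultonYoungTableaux1997, Appendix B §B.2 Exercise 5] -/
theorem mem_supportedClasses_of_map_mem_of_surjective_of_add_eq (hX : IsSmoothProjective n X)
    (hW : IsSmoothProjective m W) (g : X ⟶ W) [Surjective g.left] {r : ℕ} (hr : m + r = n) {k c : ℕ}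
    {x : complexBetti W k} (hx : complexBetti.map g k x ∈ supportedClasses X k c) :
    x ∈ supportedClasses W k c := by
  obtain ⟨D⟩ := nonempty_kaehlerRationalDatum hX
  obtain ⟨c₀, hc₀, hc⟩ := D.exists_complexGysin_lefschetzPow_map_eq_smul_of_surjective hX hW g hr
  have hL : lefschetzPow D.Hη r k (complexBetti.map g k x) ∈ supportedClasses X (k + 2 * r) (c + r) :=
    lefschetzPow_mem_supportedClasses_add hX (D.ofRatClass_eta_mem_algebraicClasses hX) hx r
  have hg := complexGysin_mem_supportedClasses (gysinMap_restrictCompl_eq_zero_of_field ℂ)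
    complexOrientationFamily hasPoincareDuality_complexOrientationFamily hX hW g
    (show (k + 2 * r) + 2 * m = k + 2 * n by omega) (r := c + r) (s := c) (by omega) hL
  rw [hc k x] at hg
  simpa only [inv_smul_smul₀ hc₀] using (supportedClasses W k c).smul_mem c₀⁻¹ hg

/-- **Coniveau descends along EVERY surjective morphism of smooth projective complex varieties**
(no dimension hypothesis: `dim W ≤ dim X`, `dim_le_of_surjective`): `g^* x ∈ Nᶜ Hᵏ(X(ℂ); ℂ)` implies
`x ∈ Nᶜ Hᵏ(W(ℂ); ℂ)`. The equidimensional case is the tree's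
`mem_supportedClasses_of_map_mem_of_surjective`. [cite: Voisin2002, §7.3.2 Lemma 7.28 and Remark 7.29]
[cite: VoisinHodgeII2003, §9.2.4 Prop. 9.20 and Prop. 9.21 (ii)] -/
theorem mem_supportedClasses_of_map_mem_of_surjective' (hX : IsSmoothProjective n X)
    (hW : IsSmoothProjective m W) (g : X ⟶ W) [Surjective g.left] {k c : ℕ} {x : complexBetti W k}
    (hx : complexBetti.map g k x ∈ supportedClasses X k c) : x ∈ supportedClasses W k c :=
  mem_supportedClasses_of_map_mem_of_surjective_of_add_eq hX hW g (r := n - m)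
    (by have := dim_le_of_surjective hX hW g; omega) hx

/-- **Algebraicity descends along every surjective morphism**: for `g : X ⟶ W` surjective of smooth
projective complex varieties (any relative dimension) and `x ∈ H²ᵖ(W(ℂ); ℂ)`, if `g^* x` is an
algebraic class on `X` then `x` is an algebraic class on `W` ("the cycles … push forward to give the
required cycles": `x = c⁻¹ g_*(ηʳ ∪ g^* x)`). The equidimensional case is the tree's
`mem_algebraicClasses_of_map_mem_of_surjective` (Schoen's transfer).
[cite: Schoen1988HodgeWeil, §3 Cor. 3.1 (proof, pp. 24–25) and Thm. 3.2 (proof, p. 25)]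
[cite: Voisin2002, §7.3.2 Lemma 7.28 and Remark 7.29] -/
theorem mem_algebraicClasses_of_map_mem_of_surjective' (hX : IsSmoothProjective n X)
    (hW : IsSmoothProjective m W) (g : X ⟶ W) [Surjective g.left] {p : ℕ} {x : complexBetti W (2 * p)}
    (hx : complexBetti.map g (2 * p) x ∈ algebraicClasses X p) : x ∈ algebraicClasses W p :=
  mem_supportedClasses_of_map_mem_of_surjective' hX hW g hx

/-- **Subspace form**: a subspace `S ⊆ H²ᵖ(W(ℂ); ℂ)` whose pull-back `g^* S` along a surjective
`g : X ⟶ W` consists of algebraic classes on `X` consists of algebraic classes on `W`.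
[cite: Schoen1988HodgeWeil, §3 Cor. 3.1 (proof, pp. 24–25)] [cite: Voisin2002, §7.3.2 Remark 7.29] -/
theorem le_algebraicClasses_of_map_le_of_surjective' (hX : IsSmoothProjective n X)
    (hW : IsSmoothProjective m W) (g : X ⟶ W) [Surjective g.left] {p : ℕ}
    {S : Submodule ℂ (complexBetti W (2 * p))}
    (hS : S.map (complexBetti.map g (2 * p)).hom ≤ algebraicClasses X p) :
    S ≤ algebraicClasses W p := fun _ hx ↦
  mem_algebraicClasses_of_map_mem_of_surjective' hX hW g (hS (Submodule.mem_map_of_mem hx))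

/-- **`(g^*)⁻¹ (Nᶜ Hᵏ(X)) ≤ Nᶜ Hᵏ(W)`** as submodules, for `g : X ⟶ W` surjective.
[cite: Voisin2002, §7.3.2 Lemma 7.28 and Remark 7.29] [cite: VoisinHodgeII2003, §9.2.4 Prop. 9.21 (ii)] -/
theorem supportedClasses_comap_map_le_of_surjective (hX : IsSmoothProjective n X)
    (hW : IsSmoothProjective m W) (g : X ⟶ W) [Surjective g.left] (k c : ℕ) :
    (supportedClasses X k c).comap (complexBetti.map g k).hom ≤ supportedClasses W k c := fun _ hx ↦
  mem_supportedClasses_of_map_mem_of_surjective' hX hW g hx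

end Literature.AlgebraicGeometry.HodgeTheory

end
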